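import Mathlib
import HarnessLib
import HarnessLib.Audit
import Summits.SmoothPoincare4.Statement
import Literature.Topology.FourManifolds.HomotopySpheres
import Literature.Topology.FourManifolds.HomotopyS4CompactProofs
import Literature.Topology.FourManifolds.HomotopyS4OrientableProofs
import Literature.Topology.FourManifolds.SphereSimplyConnected
import HarnessLib.Audit.Status.Attr

/-!
Route: LegendrianSphereS7

DORMANT since 2026-08-22T23:17:07Z (reconciler: no traction for 5.7 d (last activity item-evidence-added at 2026-08-17T04:46:01Z); parked, not closed — `ledger route dormant route-SmoothPoincare4-LegendrianSphereS7 --off` to reactivate) — unstaffed, not closed; items shared with open routes are served there. `ledger route dormant <id> --off` reactivates.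

# Route LegendrianSphereS7 — CONDITIONAL (smooth nearby Lagrangian conjecture for T*S⁴) — SPC4 ⇔
every homotopy 4-sphere is an exact Lagrangian in T*S⁴; T*Σ ≅ T*S⁴ via Legendrian unknotting of Λ_Σ
⊂ S⁷

Card realised: legendrian-sphere-s7 (spine, sole card). X = A ∧ B, "it suffices to show X". (A)
ExactLagrangianHomotopySpheres: every
homotopy 4-sphere Σ admits an exact Lagrangian embedding into the cotangent bundle T*S⁴ with its
canonical Liouville form — the
typable core of the card's X′ = (C) CotangentLiouvilleEquivalence "T*Σ is exact-symplectomorphic to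
T*S⁴", whose Weinstein-handle form is
the card's LEG: the Legendrian 3-sphere Λ_Σ ⊂ (S⁷, ξ_std) along which the single critical handle of
T*Σ is attached (Morse function on Σ
with one maximum; subcritical sublevel flexibly identified with B⁸_std) is Legendrian-unknotted; C →
A is formal (zero section).
(B) NearbyLagrangianSphereFour — the CONDITIONAL, filed as the first crux: every closed connected
exact Lagrangian submanifold of T*S⁴ is
diffeomorphic to S⁴ (smooth form of Arnold's nearby Lagrangian conjecture for S⁴,
EkholmKraghSmith2016 p. 3). Both A and B follow from
SPC4 (zero section; Kragh2013 makes any such Lagrangian a homotopy 4-sphere), so X ⇔ SPC4: an exotic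
4-sphere is EITHER invisible to
T*S⁴ as a Lagrangian (¬A, symplectic detection of exoticness) OR a counterexample to the nearby
Lagrangian conjecture (¬B).
Lean model used in every item: T*S⁴ = TS⁴ = {(q,p) ∈ ℝ⁵ × ℝ⁵ : ‖q‖ = 1, ⟪q,p⟫ = 0} with Liouville
form λ = ⟪p, dq⟫ (= λ_can under the
round-metric identification); an exact Lagrangian embedding of M is a smooth injective immersion
(q,p) : M → ℝ⁵ × ℝ⁵ into TS⁴ with
⟪p, Dq(·)⟫ = dg for a smooth g : M → ℝ (isotropy follows, dim M = 4 gives Lagrangian).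
Lean: `ExactLagrangianHomotopySpheres ∧ NearbyLagrangianSphereFour`

## Assembly
Pure logic plus the in-tree reduction: given B and A, for S : HomotopySphere 4 take (q,p,g) from A;
S.carrier is compact (instance),
connected (S ≃ₕ S⁴ and `Literature.Topology.FourManifolds.simplyConnectedSpace_sphere_four_holds` +
`ContinuousMap.HomotopyEquiv.simplyConnectedSpace`),
so B gives S.carrier ≃ₘ S⁴; then `Literature.SPC4.smoothPoincare4_of_forall_homotopySphere` with the
proved facts
`compactSpace_of_homotopyEquiv_sphere_four_holds`, `isOrientable_of_homotopyEquiv_sphere_four_holds`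
(Theorems/PICReduction.lean) yields
SmoothPoincare4. PROVABLE NOW: this 9-line proof compiles in the planner's Sketch.lean (rc 0, no
sorry).

CONDITIONAL on EkholmKraghSmith2016 — this route is an explicit reduction to that named conjecture (D-0019: crux floor waived).

Rationale: WHY THIS LINE. EkholmKraghSmith2016 (p. 3) print the bridge "weak nearby Lagrangian ⇒ (N ↪ T*M exact
Lagrangian ⇒ N ≅ M) ⇒ (T*N ≅ T*M ⇒ N ≅ M)" and, with
Abouzaid2012, show that T*Σ remembers [Σ] ∈ Θ_n/bP_{n+1} for n ≥ 5 via parallelizable fillings built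
from holomorphic-disc moduli; at
n = 4 both of their mechanisms are void (every homotopy 4-sphere bounds a contractible 5-manifold,
and the §3.6 "reparametrised unknot"
picture needs Σ = D⁴ ∪_φ D⁴, a class that is standard since π₀Diff⁺(S³) = 1, Cerf1968), so the n = 4
case has never been filed: this route
files it as SPC4 ⇔ A ∧ B with both halves symplectic, and moves the 4-dimensional handle complexity
of Σ (1- /3-handle trading,
Andrews–Curtis) into ONE rigid object two dimensions up — the Legendrian knot type of Λ_Σ ⊂ S⁷ —
because subcritical Weinstein handles
cancel by the h-principle (CieliebakEliashberg2012 Ch. 14) and a contractible 8-manifold with simply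
connected boundary is B⁸ (Smale).
Imported: symplectic topology of cotangent bundles (FukayaSeidelSmith2007, Nadler2009,
Abouzaid2012NearbyMaslov, Kragh2013,
AbouzaidKragh2018: closed exact Lagrangians in T*S⁴ are homotopy 4-spheres), Weinstein flexibility
(CieliebakEliashberg2012), Legendrian
surgery and front calculus (BourgeoisEkholmEliashberg2012, EkholmLekili2023, CasalsMurphy2019),
metastable unknotting (Haefliger1962:
S³ ⊂ S⁷ unknots smoothly, 2·7 ≥ 3·3 + 4). Catalogue: a geometric lift (symplectisation, two
dimensions up); no spectral, probabilistic or
model-theoretic reformulation touches the statement. Versus existing routes: SymplecticCap posits a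
symplectic form ON Σ ∖ p and recognises
B⁴ by Gromov–McDuff; here no structure on Σ is posited — T*Σ's canonical one is used — and the
recognition input is the nearby Lagrangian
conjecture; no other route or card uses cotangent bundles or Legendrians in S⁷
(lagrangian-whitney-double-point immerses Σ in ℂ⁴). Negatives
index: empty.

RANKED CRUXES. #2 NearbyLagrangianSphereFour (crux) — [the CONDITIONAL, filed first] smooth nearby
Lagrangian conjecture for S⁴: every closed (compact, boundaryless), connected, smooth 4-manifold M
admitting an exact Lagrangian embedding into (T*S⁴, λ_can) — in the model: smooth q p : M → ℝ⁵ and g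
: M → ℝ with ‖q‖ = 1, ⟪q,p⟫ = 0, (q,p) an injective immersion, dg = ⟪p, Dq·⟫ — is diffeomorphic to
S⁴. Known: such M is homotopy equivalent (even simple homotopy equivalent) to S⁴
(FukayaSeidelSmith2007 and Nadler2009 under π₁ = 1 and Maslov 0; Abouzaid2012NearbyMaslov;
Kragh2013; AbouzaidKragh2018), hence homeomorphic to S⁴ (Freedman1982); so the item ⇔ "no EXOTIC
homotopy 4-sphere is an exact Lagrangian in T*S⁴", and SPC4 ⇒ item. Arnold's conjecture proper
(Hamiltonian isotopic to the zero section) is stronger and not asked. [difficulty: open-problem]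
(why it might fail: Fails iff an exotic homotopy 4-sphere embeds as an exact Lagrangian in T*S⁴
(needs ¬SPC4); Floer theory reaches only L ≃ S⁴ (Kragh2013, AbouzaidKragh2018) and, for fillings of
the unknot Λ₀ ⊂ S⁷, contractibility (arXiv:1501.04258 Thm 4.7; KimKwon2024 Thm A).)
[EkholmKraghSmith2016, Kragh2013, AbouzaidKragh2018, Abouzaid2012NearbyMaslov,
FukayaSeidelSmith2007, Nadler2009, arXiv:1501.04258, doi:10.4310/jsg.241001212513]
#3 ExactLagrangianHomotopySpheres (crux) — [flexibility half; the typable core of the card's X′]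
every homotopy 4-sphere Σ (Literature `HomotopySphere 4`) admits an exact Lagrangian embedding into
(T*S⁴, λ_can): smooth q p : Σ → ℝ⁵, g : Σ → ℝ with ‖q‖ = 1, ⟪q,p⟫ = 0, (q,p) injective immersion, dg
= ⟪p, Dq·⟫. SPC4 ⇒ item (q = inclusion ∘ diffeomorphism, p = 0, g = 0; the S⁴ case is
machine-checked in the planner's SketchSanity.lean). Implied by CotangentLiouvilleEquivalence
(support item CotangentToLagrangian). This is the n = 4 case of the Ekholm–Kragh–Smith / Abouzaid
question "which homotopy spheres are Lagrangian in T*Sⁿ"; its NEGATION for one Σ is a symplectic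
certificate of exoticness and refutes SPC4. [difficulty: open-problem] (why it might fail: An exotic
Σ may admit no exact Lagrangian embedding into T*S⁴: the n ≥ 5 analogue is FALSE for Σ ∉ bP_(n+1)
(Abouzaid2012; EkholmKraghSmith2016 Thm 1.1) and closed exact Lagrangians obey no h-principle; at n
= 4 neither an obstruction nor a construction is known.) [Abouzaid2012, EkholmKraghSmith2016,
CieliebakEliashberg2012]
#4 CotangentLiouvilleEquivalence (crux) — [the card's X′; Legendrian content] for every homotopy
4-sphere Σ the Liouville manifolds (T*Σ, λ_can) and (T*S⁴, λ_can) are exact-symplectomorphic. Lean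
model: T*Σ := Mathlib's `TangentBundle (𝓡 4) Σ` with the Liouville form λ_e((x,v); ξ) = ⟪De_x v,
D(e∘π) ξ⟫ induced by ANY smooth embedding e : Σ → ℝᴺ (this is exactly the pull-back of λ_can under
the metric isomorphism TΣ ≅ T*Σ for g = e*euclid, so the statement does not depend on e; Whitney
supplies one); asked: a smooth bijective immersion Φ = (Q,P) : TΣ → TS⁴ ⊂ ℝ⁵ × ℝ⁵ (a diffeomorphism
onto TS⁴, equal dimension 8) and smooth G with Φ*⟪p,dq⟫ − λ_e = dG. Since H¹(TΣ; ℝ) = 0,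
'symplectomorphic' already gives 'exact-symplectomorphic', so this is EkholmKraghSmith2016's
question "is T*Σ symplectomorphic to T*Sⁿ" at n = 4; SPC4 ⇒ item (cotangent lift of a diffeomorphism
composed with the two metric isomorphisms, G = 0). Weinstein-handle form (the card's LEG, informal
until Weinstein/Legendrian definitions exist): T*Σ ≅ B⁸_std ∪_Λ H⁴ with Λ = Λ_Σ ⊂ (S⁷, ξ_std) a
Legendrian 3-sphere, smoothly unknotted (Haefliger1962), expected formally isotopic to Λ₀ (rotation
class in π₃(U(3)) ≅ ℤ killed by the contractible exact Lagrangian filling Σ° = Σ ∖ D⁴ of Λ_Σ; almost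
complex structures on D*Σ ≃ S⁴ are unique up to homotopy as π₄(SO(8)/U(4)) = 0 — to be certified in
the construction item), NOT loose (SH(T*Σ) ≅ H_*(LΣ) ≠ 0, AbbondandoloSchwarz2005 +
BourgeoisEkholmEliashberg2012); LEG = "Λ_Σ is Legendrian isotopic to the unknot Λ₀ modulo Liouville
automorphisms of B⁸" ⇒ item; the front of Λ_Σ is computable from a Kirby diagram of Σ by
CasalsMurphy2019 calculus. [difficulty: open-problem] (why it might fail: Λ_Σ may be genuinely
knotted while every holomorphic-curve invariant of it is computed by C_*(ΩΣ) ≃ C_*(ΩS⁴)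
(EkholmLekili2023, Abouzaid2011CotangentFibre): invisible knotting with no engine either way; or the
item holds only because SPC4 does.) [EkholmKraghSmith2016, CieliebakEliashberg2012,
CasalsMurphy2019, EkholmLekili2023, BourgeoisEkholmEliashberg2012, Haefliger1962,
AbbondandoloSchwarz2005]
#5 EkholmKraghSmith2016 (crux) — [the route's declared conditional_on, carried AS A CRUX by name
since the route-choice repair 2026-08-16, option (a); D-0027 §2.2: a conditional bridge lists its
condition among its cruxes] Ekholm–Kragh–Smith cotangent rigidity at n = 4: for every homotopy
4-sphere Σ, IF (T*Σ, λ_can) is exact-symplectomorphic to (T*S⁴, λ_can) — hypothesis = verbatim the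
body of CotangentLiouvilleEquivalence for this Σ (same TangentBundle/λ_e model) — THEN Σ ≅ S⁴. This
is the n = 4 case of the question of arXiv:1503.00473 p. 3 ('to what extent the symplectic topology
of T*M remembers the smooth structure on M'; their Thm 1.1 needs n > 4 odd, Abouzaid2012 needs n =
4k+1). Relation to the other items: the paper's p. 3 remark (image of the zero section) gives
NearbyLagrangianSphereFour (#2, the conditional in its STRONG, Lagrangian form) ⇒ #5 (its WEAK,
cotangent form), so #5 is downstream of #2 and SPC4 ⇒ #5 trivially; the route decides SPC4 along
EITHER pair {#2, #3} (deciding theorem `closes`) or {#5, #4} (support AssemblyEKS). A seat handed #5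
as a proving target answers verdict open-problem; its value is as the named premise and as a
refutation target (¬#5 for an explicit Σ exhibits an exotic S⁴ whose cotangent bundle is standard).
[difficulty: open-problem] (why it might fail: Fails iff some exotic Σ⁴ has T*Σ
exact-symplectomorphic to T*S⁴: EKS Thm 1.1 (n > 4 odd) and Abouzaid2012 see [Σ] only modulo
bP_(n+1), via parallelizable fillings from disc moduli — void at n = 4 (every Σ⁴ bounds a
contractible W⁵); all Floer invariants of T*Σ are homotopy invariants of Σ.) [EkholmKraghSmith2016,
arXiv:1503.00473, doi:10.1142/s1793525316500199, Abouzaid2012, Kragh2013, AbouzaidKragh2018]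
#9 CotangentToLagrangian (support) — glue CotangentLiouvilleEquivalence →
ExactLagrangianHomotopySpheres: take a Whitney embedding e (Mathlib
`exists_embedding_euclidean_of_compact`), the Φ = (Q,P), G of the crux, and compose with the zero
section s (Mathlib `Bundle.zeroSection`, `Bundle.contMDiff_zeroSection`): q = Q ∘ s, p = P ∘ s, g =
G ∘ s; s*λ_e = 0 because v = 0 on the zero section, so dg = s*(Φ*λ₀) = ⟪p, Dq·⟫ by the chain rule
(`mfderiv_comp`); injectivity and immersivity of s and Φ compose. Pure differential-geometric
bookkeeping over Mathlib's tangent-bundle API. [difficulty: M] [CieliebakEliashberg2012,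
EkholmKraghSmith2016]
#9 AssemblyEKS (support) — the C-line assembly EkholmKraghSmith2016 → CotangentLiouvilleEquivalence
→ SmoothPoincare4: unfold SmoothPoincare4 to its binders, package M ≃ₕ S⁴ as S : HomotopySphere 4
with the PROVED tree theorems compactSpace_of_homotopyEquiv_sphere_four_holds /
isOrientable_of_homotopyEquiv_sphere_four_holds, then `hE S (hC S)`. PROVABLE NOW (6 lines, planner
Sketch.lean rc 0 at rev 1). [difficulty: provable-now] [EkholmKraghSmith2016]

TWO-LAYER PLAN. Foreseen glued splits (none filed now): CotangentLiouvilleEquivalence ⇐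
LegendrianUnknotting (LEG: Λ_Σ ≃ Λ₀ mod Liouville automorphisms
of B⁸) → SubcriticalStandard (the subcritical sublevel of T*Σ is Weinstein-homotopic to B⁸_std:
Smale + CieliebakEliashberg2012 Ch. 14,
known) → CotangentLiouvilleEquivalence (k = 2), once Weinstein/Legendrian definitions land;
NearbyLagrangianSphereFour ⇐ OnePointNormalisation
(every closed exact Lagrangian in T*S⁴ is Hamiltonian isotopic to one meeting the fibre T*_N S⁴
transversally in one point) → UnknotFillings
(every exact Lagrangian filling of the Legendrian unknot Λ₀ ⊂ (S⁷, ξ_std) in B⁸ is diffeomorphic to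
D⁴ — the 8-dimensional
Eliashberg–Polterovich statement, EliashbergPolterovich1996 being n = 2) →
NearbyLagrangianSphereFour (k = 2); ExactLagrangianHomotopySpheres
⇐ CotangentLiouvilleEquivalence via the filed glue (k = 1).

KILL CRITERIA. ¬A(Σ), ¬C(Σ) or ¬B for an explicit Σ each EXHIBIT AN EXOTIC S⁴ (A, B, C are all
implied by SPC4): such a refutation closes this route
`refuted:<Decl>` and every positive SPC4 route with it — the witness is the prize, handed to the
negative routes. Route-specific kills:
(i) a grounder finds B (or A) already PROVED in print ⇒ re-badge known, the bridge becomes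
unconditional (good) or the route restates a
theorem (close `superseded`); (ii) the Lean model is wrong — (TS⁴ ⊂ ℝ⁵×ℝ⁵, ⟪p,dq⟫) not
Liouville-isomorphic to (T*S⁴, λ_can), or λ_e ≠
metric pull-back of λ_can — then `--restate` (both are textbook identities: θ_(q,α)(ξ) = α(dπ ξ) =
⟪p, dq(ξ)⟫; checked by hand, and the
zero section of S⁴ is machine-checked to satisfy the clause); (iii) refuters grade the A/B split
tautological AND C engine-less ⇒ pivot to
B + C only with LEG filed as C's child, or close `exhausted` with the census "Floer-blindness of
cotangent bundles" proposed as a new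
catalogue barrier. Proved elsewhere: SPC4 by any route moots this one; ¬SPC4 elsewhere turns A/B/C
into three concrete symplectic
questions about the witness (keep open as a negative-side programme only if the tenure planner
re-theses it).

NOT DECOMPOSED YET. LEG itself and the construction item "Λ_Σ exists with T*Σ ≅ B⁸_std ∪_Λ H⁴"
(interface vs construction kept separate per D-0014) — need
Liouville/Weinstein domains in dimension 2n, Weinstein handle attachment along a Legendrian sphere,
Legendrian isotopy in (S⁷, ξ_std);
the two KNOWN inputs of the Legendrian picture, filed as cite facts only when LEG becomes an item:
subcritical standardisation
(CieliebakEliashberg2012 Ch. 14 + Smale's h-cobordism theorem in dimension 8) and the smooth shadow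
TΣ ≅ TS⁴ (Freedman1982 +
KirbySiebenmann1977 Essay IV §10 with π₄(TOP/O) = 0; vector bundles over Σ ≃ S⁴ with (e, p₁) = (2,
0) agree); the one-point
normalisation and UnknotFillings children of B (see Two-layer plan); calibration computations —
Casals–Murphy fronts of Λ_Σ for a Gluck
twist of a ribbon 2-knot and for the Cappell–Shaneson/Gompf sphere of the matrix A₀ (both KNOWN ≅
S⁴, so their fronts must reduce to
Λ₀: a calibration of the calculus), then the first open Gompf matrix — kit jobs once a front encoder
exists; refuter-facing negative
companions ¬A(Σ), ¬C(Σ) for explicit Σ (each ⇒ ¬SPC4; file only with a candidate Σ in hand).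

CHEAPEST FALSIFIER. A literature lookup: is "closed exact Lagrangians in T*S⁴ are diffeomorphic to
S⁴" (B) or "exotic homotopy 4-spheres (if any) do / do not
embed as Lagrangians in T*S⁴" (A) already a theorem? Run by me 2026-08-15: zbMATH 'nearby Lagrangian
conjecture sphere' (3 hits: Abouzaid2012;
Guillermou, Astérisque 440 (2023) — sheaf proof of homotopy equivalence; Torricelli AGT 2024 —
projective twists), 'exact Lagrangian cotangent
bundle homotopy equivalent diffeomorphic' (1, Damian 2012, irrelevant), 'Legendrian unknot sphere
exact Lagrangian filling unique ball' (1: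
KimKwon2024 = doi:10.4310/jsg.241001212513, READ pp. 1–3: Thm A gives only homology balls, Remark
1.2 leaves even π₁ of fillings open in high
dimension, Thm B 'diffeomorphic to the ball' needs n ≥ 6 AND real fillings); EkholmKraghSmith2016
full text grepped (pp. 3, 4, 15, 16 read):
every statement has n > 4. Nothing kills the line; B stays open as stated. Second-cheapest (minutes,
Lean): prove SPC4 →
ExactLagrangianHomotopySpheres to certify the clause shape — done for the zero section of S⁴ itself
in SketchSanity.lean (rc 0).

NUMBERS. Θ₄ (h-cobordism classes) = 0 (KervaireMilnor1963); π₀Diff⁺(S³) = 1 (Cerf1968); Haefliger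
unknotting of Sᵏ ⊂ Sⁿ for 2n ≥ 3k + 4: (k,n) =
(3,7) gives 14 ≥ 13 (Haefliger1962); π₃(U/O) = ℤ/2, π₄(SO/U) = π₅(O) = 0 (Bott), so almost complex
structures on D*S⁴ ≃ S⁴ are unique up to
homotopy; πₖ(TOP/O) = 0 for k ≤ 6 except π₃ = ℤ/2 (KirbySiebenmann1977), so [S⁴, TOP/O] = 0;
EKS/Abouzaid obstructions live in
Θ_n/bP_(n+1), n ≥ 5 — void at n = 4. Items at open: 5 (3 cruxes, 1 support, 1 assembly); signature
lengths 796/620/1221/62/77 chars; all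
elaborate (SketchRoute.lean rc 0, imports Mathlib +
Literature.Topology.FourManifolds.HomotopySpheres + the Statement). Items since rev 1 (route-choice
(a), 2026-08-16): 7 = 4 cruxes (#2–#5) + 2 support (CotangentToLagrangian, AssemblyEKS) + 1
assembly; deciding theorem closes (hB : #2) (hA : #3) : SmoothPoincare4 native-OK (axioms propext /
Classical.choice / Quot.sound); cone 12 project constants, 0 unproved.

DEFINITION REQUESTS. None filed now — all five items are typed over Mathlib (TangentBundle, mfderiv,
ContMDiff, Metric.sphere) and
`Literature.Topology.FourManifolds.HomotopySphere`. Recorded for the layer-2 item LEG (topic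
Literature/Geometry/Symplectic, shared with
any future high-dimensional symplectic route): LiouvilleDomain / WeinsteinStructure in dimension 2n
(model 𝓡∂ (2n)), LegendrianSphere and
LegendrianIsotopic in (S^(2n−1), ξ_std), WeinsteinHandleAttach (result of attaching a critical
handle along a Legendrian sphere),
cotangentLiouville (T*M with λ_can — or the TangentBundle + λ_e model used here, packaged), and a
packaged
`IsExactLagrangianEmbeddingCotangentSphere q p` that is Iff.rfl-equal to the clause inlined in items
#2/#3 (file only if grounders ask).

Novelty: Searches (2026-08-15, this session): zbMATH 'nearby Lagrangian conjecture sphere' (3), 'exact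
Lagrangian cotangent bundle homotopy
equivalent diffeomorphic' (1), 'Legendrian unknot sphere exact Lagrangian filling unique ball' (1 →
KimKwon2024 read pp. 1–3, 14–15),
'nearby Lagrangian conjecture cotangent bundle four-sphere exotic smooth structure symplectomorphic'
(0); `lit read arxiv:1503.00473` grep
(32 hits; pp. 3, 4, 15, 16 read); OpenAlex/S2/arXiv answered HTTP 429 and `lit galaxy search "nearby
Lagrangian conjecture" --star all`
queued out (> 90 s) — logged, not retried into a claim; plus the refuter novelty audit of the card
(2026-08-15: zbMATH ×2, galaxy all
'cotangent bundle of an exotic sphere' (0), EKS pp. 3, 15, 16) and the card author's `lit frontier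
SmoothPoincare4 --since 2020` /
`lit bridges SmoothPoincare4 --cross any` (no symplectic paper cites the SPC4 roots).
Nearest prior art found: EkholmKraghSmith2016 (doi:10.1142/s1793525316500199) p. 3 prints the bridge
weak-NLC ⇒ (T*N ≅ T*M ⇒ N ≅ M) and
§3.6/Cor. 3.12 the handle picture 'T* of an exotic sphere = ball ∪ n-handle on the reparametrised
Legendrian unknot' (n even ≥ 6);
Abouzaid2012 (n = 4k+1); Kragh2013 / AbouzaidKragh2018 / FukayaSeidelSmith2007 / Nadler2009
(homotopy type of nearby Lagrangians);
Chantraine–Dimitroglou Rizell–Ghiggini–Golovko arXiv:1501.04258 Thm 4.7 and KimKwon2024 Thm A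
(fillings of the standard Legendrian sphere
are contractible / homology balls); CieliebakEliashberg2012 (subcritical  [refs: 10.1142/s1793525316500199, 1503.00473, 1501.04258, arxiv:1503.00473, doi:10.1142/s1793525316500199, EkholmKraghSmith2016, Abouzaid2012, Kragh2013, AbouzaidKragh2018, FukayaSeidelSmith2007, Nadler2009, CieliebakEliashberg2012, CasalsMurphy2019]

Barriers (technique_class: cotangent-rigidity Legendrian-surgery conditional-bridge): - technique_class: cotangent-rigidity Legendrian-surgery conditional-bridge
- Literature.Barriers.SmoothPoincare4.HCobordismBarrierFour: h-cobordism/Smale recognition is used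
only in dimension 8 (subcritical sublevel of T*Σ ≅ B⁸; D*Σ ≅ D*S⁴), where it is a theorem; no
5-dimensional h-cobordism ⇒ diffeomorphism step occurs anywhere in A, B, C or the assembly.
- Literature.Barriers.SmoothPoincare4.TwistedSphereBarrierFour: it SHAPES the route —
EkholmKraghSmith2016 §3.6 describes Λ_Σ as a reparametrised unknot, which presupposes Σ = D⁴ ∪_φ D⁴,
a class already standard (π₀Diff⁺(S³) = 1); hence the datum here is the Legendrian knot type of Λ_Σ
built from an arbitrary handle decomposition of Σ, and nothing exotic is sought among twisted
spheres; Cerf is used nowhere.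
- Literature.Barriers.SmoothPoincare4.TopologicalBarrierFour: the would-be invariants (Liouville
type of T*Σ; exact-Lagrangian embeddability of Σ in T*S⁴) are defined from the SMOOTH structure and
are complete modulo B, so not functions of the homeomorphism type a priori; CONCEDED: every
computable Floer shadow (wrapped Fukaya category of T*Σ ≃ C_*(ΩΣ)-modules,
Abouzaid2011CotangentFibre; SH ≅ H_*(LΣ), AbbondandoloSchwarz2005; CE-dga of Λ_Σ, EkholmLekili2023)
is a homotopy invariant of Σ hence blind — an uncatalogued barrier ("Floer invariants of cotangent
bundles are homotopy invariants") this route proposes for the catalogue; the bet is on non-algebraic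
rigidity (disc-moduli fillings à la Abouzaid2012, front calculu

History (route lifecycle, newest last):
- 2026-08-22T23:17:07Z · DORMANT — reconciler: no traction for 5.7 d (last activity item-evidence-added at 2026-08-17T04:46:01Z); parked, not closed — `ledger route dormant route-SmoothPoincare4- (operator:999:2899761)

sub-problem: SmoothPoincare4 · status: dormant · opened planner-plancard-SmoothPoincare4-SmoothPoinca-a5be5af8-0 2026-08-15T11:30:14Z · rev 3 · ledger route-SmoothPoincare4-LegendrianSphereS7
GENERATED by the gate from the ledger (D-0016/17). Provers cite these decls: `theorem foo : Summit.SmoothPoincare4.SmoothPoincare4.Theses.LegendrianSphereS7.<Decl> := …` in Summits/SmoothPoincare4/SmoothPoincare4/Theorems/<Name>.lean.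
-/

namespace Summit.SmoothPoincare4.SmoothPoincare4.Theses.LegendrianSphereS7

open scoped BigOperators Topology Manifold Classical MeasureTheory ProbabilityTheory Matrix InnerProductSpace ComplexConjugate ContinuousMap ContDiff
open Filter Set Function TopologicalSpace MeasureTheory

attribute [summit_statement] _root_.SmoothPoincare4
-- H21.Audit: conditional_on 'EkholmKraghSmith2016' is not an accepted declaration — no route_premise tag

open Literature.SPC4

/-- item stmt-SmoothPoincare4-4229 · crux · rank 2 · open · by planner
why it might fail: Fails iff an exotic homotopy 4-sphere embeds as an exact Lagrangian in T*S⁴ (needs ¬SPC4); Floer theory reaches only L ≃ S⁴ (Kragh2013, AbouzaidKragh2018) and, for fillings of the unknot Λ₀ ⊂ S⁷, contractibility (arXiv:1501.04258 Thm 4.7; KimKwon2024 Thm A).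
sources: EkholmKraghSmith2016, Kragh2013, AbouzaidKragh2018, Abouzaid2012NearbyMaslov, FukayaSeidelSmith2007, Nadler2009
[crux] [the CONDITIONAL, filed first] smooth nearby Lagrangian conjecture for S⁴: every closed
(compact, boundaryless), connected, smooth 4-manifold M admitting an exact Lagrangian embedding into
(T*S⁴, λ_can) — in the model: smooth q p : M → ℝ⁵ and g : M → ℝ with ‖q‖ = 1, ⟪q,p⟫ = 0, (q,p) an
injective immersion, dg = ⟪p, Dq·⟫ — is diffeomorphic to S⁴. Known: such M is homotopy equivalent
(even simple homotopy equivalent) to S⁴ (FukayaSeidelSmith2007 and Nadler2009 under π₁ = 1 and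
Maslov 0; Abouzaid2012NearbyMaslov; Kragh2013; AbouzaidKragh2018), hence homeomorphic to S⁴
(Freedman1982); so the item ⇔ "no EXOTIC homotopy 4-sphere is an exact Lagrangian in T*S⁴", and SPC4
⇒ item. Arnold's conjecture proper (Hamiltonian isotopic to the zero section) is stronger and not
asked. [difficulty: open-problem] -/
@[route_item "route-SmoothPoincare4-LegendrianSphereS7", crux]
def NearbyLagrangianSphereFour : Prop :=
  ∀ (M : Type) [TopologicalSpace M] [T2Space M] [SecondCountableTopology M] [CompactSpace M] [ConnectedSpace M] [ChartedSpace (EuclideanSpace ℝ (Fin 4)) M] [IsManifold (𝓡 4) ∞ M] (q p : M → EuclideanSpace ℝ (Fin 5)) (g : M → ℝ), ContMDiff (𝓡 4) 𝓘(ℝ, EuclideanSpace ℝ (Fin 5)) ∞ q → ContMDiff (𝓡 4) 𝓘(ℝ, EuclideanSpace ℝ (Fin 5)) ∞ p → ContMDiff (𝓡 4) 𝓘(ℝ, ℝ) ∞ g → (∀ x, ‖q x‖ = 1 ∧ ⟪q x, p x⟫_ℝ = 0) → (∀ x y, q x = q y → p x = p y → x = y) → (∀ x (v : TangentSpace (𝓡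 4) x), mfderiv (𝓡 4) 𝓘(ℝ, EuclideanSpace ℝ (Fin 5)) q x v = 0 → mfderiv (𝓡 4) 𝓘(ℝ, EuclideanSpace ℝ (Fin 5)) p x v = 0 → v = 0) → (∀ x (v : TangentSpace (𝓡 4) x), mfderiv (𝓡 4) 𝓘(ℝ, ℝ) g x v = ⟪p x, mfderiv (𝓡 4) 𝓘(ℝ, EuclideanSpace ℝ (Fin 5)) q x v⟫_ℝ) → Nonempty (M ≃ₘ⟮𝓡 4, 𝓡 4⟯ Metric.sphere (0 : EuclideanSpace ℝ (Fin 5)) 1)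

/-- item stmt-SmoothPoincare4-4230 · crux · rank 3 · open · by planner
why it might fail: An exotic Σ may admit no exact Lagrangian embedding into T*S⁴: the n ≥ 5 analogue is FALSE for Σ ∉ bP_(n+1) (Abouzaid2012; EkholmKraghSmith2016 Thm 1.1) and closed exact Lagrangians obey no h-principle; at n = 4 neither an obstruction nor a construction is known.
sources: Abouzaid2012, EkholmKraghSmith2016, CieliebakEliashberg2012
[crux] [flexibility half; the typable core of the card's X′] every homotopy 4-sphere Σ (Literature
`HomotopySphere 4`) admits an exact Lagrangian embedding into (T*S⁴, λ_can): smooth q p : Σ → ℝ⁵, g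
: Σ → ℝ with ‖q‖ = 1, ⟪q,p⟫ = 0, (q,p) injective immersion, dg = ⟪p, Dq·⟫. SPC4 ⇒ item (q =
inclusion ∘ diffeomorphism, p = 0, g = 0; the S⁴ case is machine-checked in the planner's
SketchSanity.lean). Implied by CotangentLiouvilleEquivalence (support item CotangentToLagrangian).
This is the n = 4 case of the Ekholm–Kragh–Smith / Abouzaid question "which homotopy spheres are
Lagrangian in T*Sⁿ"; its NEGATION for one Σ is a symplectic certificate of exoticness and refutes
SPC4. [difficulty: open-problem] -/
@[route_item "route-SmoothPoincare4-LegendrianSphereS7", crux]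
def ExactLagrangianHomotopySpheres : Prop :=
  ∀ S : Literature.Topology.FourManifolds.HomotopySphere 4, ∃ (q p : S.carrier → EuclideanSpace ℝ (Fin 5)) (g : S.carrier → ℝ), ContMDiff (𝓡 4) 𝓘(ℝ, EuclideanSpace ℝ (Fin 5)) ∞ q ∧ ContMDiff (𝓡 4) 𝓘(ℝ, EuclideanSpace ℝ (Fin 5)) ∞ p ∧ ContMDiff (𝓡 4) 𝓘(ℝ, ℝ) ∞ g ∧ (∀ x, ‖q x‖ = 1 ∧ ⟪q x, p x⟫_ℝ = 0) ∧ (∀ x y, q x = q y → p x = p y → x = y) ∧ (∀ x (v : TangentSpace (𝓡 4) x), mfderiv (𝓡 4) 𝓘(ℝ, EuclideanSpace ℝ (Fin 5)) q x v = 0 → mfderiv (𝓡 4) 𝓘(ℝ, EuclideanSpace ℝ (Fin 5)) p x v = 0 → v = 0) ∧ (∀ x (v : TangentSpace (𝓡 4) x), mfderiv (𝓡 4) 𝓘(ℝ, ℝ) g x v = ⟪p x, mfderiv (𝓡 4) 𝓘(ℝ, EuclideanSpace ℝ (Fin 5)) q x v⟫_ℝ)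

/-- item stmt-SmoothPoincare4-4231 · crux · rank 4 · open · by planner
why it might fail: Λ_Σ may be genuinely knotted while every holomorphic-curve invariant of it is computed by C_*(ΩΣ) ≃ C_*(ΩS⁴) (EkholmLekili2023, Abouzaid2011CotangentFibre): invisible knotting with no engine either way; or the item holds only because SPC4 does.
sources: EkholmKraghSmith2016, CieliebakEliashberg2012, CasalsMurphy2019, EkholmLekili2023, BourgeoisEkholmEliashberg2012, Haefliger1962
[crux] [the card's X′; Legendrian content] for every homotopy 4-sphere Σ the Liouville manifolds
(T*Σ, λ_can) and (T*S⁴, λ_can) are exact-symplectomorphic. Lean model: T*Σ := Mathlib's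
`TangentBundle (𝓡 4) Σ` with the Liouville form λ_e((x,v); ξ) = ⟪De_x v, D(e∘π) ξ⟫ induced by ANY
smooth embedding e : Σ → ℝᴺ (this is exactly the pull-back of λ_can under the metric isomorphism TΣ
≅ T*Σ for g = e*euclid, so the statement does not depend on e; Whitney supplies one); asked: a
smooth bijective immersion Φ = (Q,P) : TΣ → TS⁴ ⊂ ℝ⁵ × ℝ⁵ (a diffeomorphism onto TS⁴, equal
dimension 8) and smooth G with Φ*⟪p,dq⟫ − λ_e = dG. Since H¹(TΣ; ℝ) = 0, 'symplectomorphic' already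
gives 'exact-symplectomorphic', so this is EkholmKraghSmith2016's question "is T*Σ symplectomorphic
to T*Sⁿ" at n = 4; SPC4 ⇒ item (cotangent lift of a diffeomorphism composed with the two metric
isomorphisms, G = 0). Weinstein-handle form (the card's LEG, informal until Weinstein/Legendrian
definitions exist): T*Σ ≅ B⁸_std ∪_Λ H⁴ with Λ = Λ_Σ ⊂ (S⁷, ξ_std) a Legendrian 3-sphere, smoothly
unknotted (Haefliger1962), expected formally isotopic to Λ₀ (rotation class in π₃(U(3)) ≅ ℤ killed
by the contractible exact Lagrangian fi -/
@[route_item "route-SmoothPoincare4-LegendrianSphereS7"]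
def CotangentLiouvilleEquivalence : Prop :=
  ∀ (S : Literature.Topology.FourManifolds.HomotopySphere 4) (N : ℕ) (e : S.carrier → EuclideanSpace ℝ (Fin N)), ContMDiff (𝓡 4) 𝓘(ℝ, EuclideanSpace ℝ (Fin N)) ∞ e → Injective e → (∀ x, Injective (mfderiv (𝓡 4) 𝓘(ℝ, EuclideanSpace ℝ (Fin N)) e x)) → ∃ (Q P : TangentBundle (𝓡 4) S.carrier → EuclideanSpace ℝ (Fin 5)) (G : TangentBundle (𝓡 4) S.carrier → ℝ), ContMDiff (𝓡 4).tangent 𝓘(ℝ, EuclideanSpace ℝ (Fin 5)) ∞ Q ∧ ContMDiff (𝓡 4).tangent 𝓘(ℝ, EuclideanSpace ℝ (Fin 5)) ∞ P ∧ ContMDiff (𝓡 4).tangent 𝓘(ℝ, ℝ) ∞ G ∧ (∀ z, ‖Q z‖ = 1 ∧ ⟪Q z, P z⟫_ℝ = 0) ∧ (∀ z w, Q z = Q w → P z = P w → z = w) ∧ (∀ a b : EuclideanSpace ℝ (Fin 5), ‖a‖ = 1 → ⟪a, b⟫_ℝ = 0 → ∃ z, Q z = a ∧ P z = b) ∧ (∀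 z (ξ : TangentSpace (𝓡 4).tangent z), mfderiv (𝓡 4).tangent 𝓘(ℝ, EuclideanSpace ℝ (Fin 5)) Q z ξ = 0 → mfderiv (𝓡 4).tangent 𝓘(ℝ, EuclideanSpace ℝ (Fin 5)) P z ξ = 0 → ξ = 0) ∧ (∀ z (ξ : TangentSpace (𝓡 4).tangent z), ⟪P z, mfderiv (𝓡 4).tangent 𝓘(ℝ, EuclideanSpace ℝ (Fin 5)) Q z ξ⟫_ℝ - @inner ℝ (EuclideanSpace ℝ (Fin N)) _ (mfderiv (𝓡 4) 𝓘(ℝ, EuclideanSpace ℝ (Fin N)) e z.proj z.snd) (mfderiv (𝓡 4).tangent 𝓘(ℝ, EuclideanSpace ℝ (Fin N)) (fun w : TangentBundle (𝓡 4) S.carrier => e w.proj) z ξ) = mfderiv (𝓡 4).tangent 𝓘(ℝ, ℝ) G z ξ)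

/-- item stmt-SmoothPoincare4-14129 · crux · rank 5 · open · by planner
why it might fail: Fails iff some exotic Σ⁴ has T*Σ exact-symplectomorphic to T*S⁴: EKS Thm 1.1 (n > 4 odd) and Abouzaid2012 see [Σ] only modulo bP_(n+1), via parallelizable fillings from disc moduli — void at n = 4 (every Σ⁴ bounds a contractible W⁵); all Floer invariants of T*Σ are homotopy invariants of Σ.
sources: EkholmKraghSmith2016, arXiv:1503.00473, doi:10.1142/s1793525316500199, Abouzaid2012, Kragh2013, AbouzaidKragh2018
[crux] [the route's named CONDITIONAL made a decl: Ekholm–Kragh–Smith cotangent rigidity at n = 4]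
for every homotopy 4-sphere Σ (Literature `HomotopySphere 4`): IF (T*Σ, λ_can) is
exact-symplectomorphic to (T*S⁴, λ_can) — hypothesis = verbatim the body of
CotangentLiouvilleEquivalence for this Σ (T*Σ := TangentBundle (𝓡 4) Σ with the Liouville form λ_e
of ANY smooth embedding e : Σ → ℝᴺ; a smooth bijective immersion Φ = (Q,P) : TΣ → TS⁴ ⊂ ℝ⁵ × ℝ⁵ and
smooth G with Φ*⟪p,dq⟫ − λ_e = dG) — THEN Σ is diffeomorphic to S⁴. This is the n = 4 case of the
question of EkholmKraghSmith2016 (arXiv:1503.00473, p. 3: 'to what extent the symplectic topology of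
T*M remembers the smooth structure on M'; their Thm 1.1: n > 4 odd, T*Σ ≅ T*Σ' only if [Σ] = ±[Σ']
in Θ_n/bP_(n+1); Abouzaid2012: n = 4k+1, T*Σ ≅ T*Sⁿ ⇒ [Σ] ∈ bP_(n+1)). By the remark printed on
their p. 3 (image of the zero section) it is implied by the weak nearby Lagrangian conjecture for S⁴
= crux NearbyLagrangianSphereFour, so it is strictly downstream of the route's conditional and
weaker than it (only Lagrangians whose complement geometry is a cotangent bundle); SPC4 ⇒ item
trivially (machine-checked in the planner's Sketch.lean). T -/
@[route_item "route-SmoothPoincare4-LegendrianSphereS7"]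
def EkholmKraghSmith2016 : Prop :=
  ∀ S : Literature.Topology.FourManifolds.HomotopySphere 4, (∀ (N : ℕ) (e : S.carrier → EuclideanSpace ℝ (Fin N)), ContMDiff (𝓡 4) 𝓘(ℝ, EuclideanSpace ℝ (Fin N)) ∞ e → Injective e → (∀ x, Injective (mfderiv (𝓡 4) 𝓘(ℝ, EuclideanSpace ℝ (Fin N)) e x)) → ∃ (Q P : TangentBundle (𝓡 4) S.carrier → EuclideanSpace ℝ (Fin 5)) (G : TangentBundle (𝓡 4) S.carrier → ℝ), ContMDiff (𝓡 4).tangent 𝓘(ℝ, EuclideanSpace ℝ (Fin 5)) ∞ Q ∧ ContMDiff (𝓡 4).tangent 𝓘(ℝ, EuclideanSpace ℝ (Fin 5)) ∞ P ∧ ContMDiff (𝓡 4).tangent 𝓘(ℝ, ℝ) ∞ G ∧ (∀ z, ‖Q z‖ = 1 ∧ ⟪Q z, P z⟫_ℝ = 0) ∧ (∀ z w, Q z = Q w → P z = P w → z = w) ∧ (∀ a b : EuclideanSpace ℝ (Fin 5), ‖a‖ = 1 → ⟪a, b⟫_ℝ = 0 → ∃ z, Q z = a ∧ P z = b) ∧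 (∀ z (ξ : TangentSpace (𝓡 4).tangent z), mfderiv (𝓡 4).tangent 𝓘(ℝ, EuclideanSpace ℝ (Fin 5)) Q z ξ = 0 → mfderiv (𝓡 4).tangent 𝓘(ℝ, EuclideanSpace ℝ (Fin 5)) P z ξ = 0 → ξ = 0) ∧ (∀ z (ξ : TangentSpace (𝓡 4).tangent z), ⟪P z, mfderiv (𝓡 4).tangent 𝓘(ℝ, EuclideanSpace ℝ (Fin 5)) Q z ξ⟫_ℝ - @inner ℝ (EuclideanSpace ℝ (Fin N)) _ (mfderiv (𝓡 4) 𝓘(ℝ, EuclideanSpace ℝ (Fin N)) e z.proj z.snd) (mfderiv (𝓡 4).tangent 𝓘(ℝ, EuclideanSpace ℝ (Fin N)) (fun w : TangentBundle (𝓡 4) S.carrier => e w.proj) z ξ) = mfderiv (𝓡 4).tangent 𝓘(ℝ, ℝ) G z ξ)) → Nonempty (S.carrier ≃ₘ⟮𝓡 4, 𝓡 4⟯ Metric.sphere (0 : EuclideanSpace ℝ (Fin 5)) 1)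

/-- item stmt-SmoothPoincare4-14130 · support · rank 9 · open · by planner
sources: EkholmKraghSmith2016
[support] C-line assembly EkholmKraghSmith2016 → CotangentLiouvilleEquivalence → SmoothPoincare4:
unfold SmoothPoincare4 to its binders, package M ≃ₕ S⁴ as S : HomotopySphere 4 using the PROVED tree
theorems compactSpace_of_homotopyEquiv_sphere_four_holds and
isOrientable_of_homotopyEquiv_sphere_four_holds, then `hE S (hC S)`. PROVABLE NOW: 6-line proof in
the planner's Sketch.lean (rc 0). [deps: EkholmKraghSmith2016, CotangentLiouvilleEquivalence]
[difficulty: provable-now] -/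
@[route_item "route-SmoothPoincare4-LegendrianSphereS7"]
def AssemblyEKS : Prop :=
  EkholmKraghSmith2016 → CotangentLiouvilleEquivalence → SmoothPoincare4

/-- item stmt-SmoothPoincare4-4232 · support · rank 9 · open · by planner
sources: CieliebakEliashberg2012, EkholmKraghSmith2016
[support] glue CotangentLiouvilleEquivalence → ExactLagrangianHomotopySpheres: take a Whitney
embedding e (Mathlib `exists_embedding_euclidean_of_compact`), the Φ = (Q,P), G of the crux, and
compose with the zero section s (Mathlib `Bundle.zeroSection`, `Bundle.contMDiff_zeroSection`): q =
Q ∘ s, p = P ∘ s, g = G ∘ s; s*λ_e = 0 because v = 0 on the zero section, so dg = s*(Φ*λ₀) = ⟪p,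
Dq·⟫ by the chain rule (`mfderiv_comp`); injectivity and immersivity of s and Φ compose. Pure
differential-geometric bookkeeping over Mathlib's tangent-bundle API. [difficulty: M] -/
@[route_item "route-SmoothPoincare4-LegendrianSphereS7"]
def CotangentToLagrangian : Prop :=
  CotangentLiouvilleEquivalence → ExactLagrangianHomotopySpheres

/-- item stmt-SmoothPoincare4-4233 · assembly · rank 1 · open · by planner
sources: EkholmKraghSmith2016, Kragh2013, KervaireMilnor1963
[assembly] NearbyLagrangianSphereFour → ExactLagrangianHomotopySpheres → SmoothPoincare4
(conditional first, then the flexibility half; CotangentLiouvilleEquivalence enters through the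
support glue CotangentToLagrangian → ExactLagrangianHomotopySpheres). -/
@[route_item "route-SmoothPoincare4-LegendrianSphereS7"]
def Assembly : Prop :=
  NearbyLagrangianSphereFour → ExactLagrangianHomotopySpheres → SmoothPoincare4

/-! D-0027 §2.1 — DECIDING THEOREM (planner-authored via `route open/edit --closes-file`; by planner-rchoice-SmoothPoincare4-LegendrianSphe-6b19f5c2-0 2026-08-16T03:04:11Z):
its hypotheses are this route's items and its conclusion the sub-problem Statement (glue_lint), and it elaborates with this file. -/

@[closes "route-SmoothPoincare4-LegendrianSphereS7"] theorem closes (hB : NearbyLagrangianSphereFour) (hA : ExactLagrangianHomotopySpheres) :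
    _root_.SmoothPoincare4 := by
  intro M _ _ _ _ _ e
  haveI : CompactSpace M :=
    Literature.Topology.FourManifolds.compactSpace_of_homotopyEquiv_sphere_four_holds M e
  obtain ⟨o⟩ :=
    Literature.Topology.FourManifolds.isOrientable_of_homotopyEquiv_sphere_four_holds M e
  haveI : SimplyConnectedSpace (Metric.sphere (0 : EuclideanSpace ℝ (Fin 5)) 1) :=
    Literature.Topology.FourManifolds.simplyConnectedSpace_sphere_four_holds
  haveI : SimplyConnectedSpace M := e.simplyConnectedSpace
  obtain ⟨q, p, g, hq, hp, hg, hsph, hinj, himm, hex⟩ := hA ⟨M, o, ⟨e⟩⟩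
  exact hB M q p g hq hp hg hsph hinj himm hex

end Summit.SmoothPoincare4.SmoothPoincare4.Theses.LegendrianSphereS7
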